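import Mathlib
import Summits.Ventures.PercRepro2.SeriesEdge
import Summits.Ventures.PercRepro2.LeafRowCutOneFar

/-!
# The series reduction of row (LEAF-½): an unmarked vertex of degree two is an edge
(blind cell PercRepro2, p5 g29; `proofs/P5-OEDGE.md` §39 (7))

night-1's series reduction (`SeriesEdge.lean`: `x` carries exactly the two edges `e₁ = {u, x}`,
`e₂ = {x, y}`; the reduced graph adjoins the edge `{u, y}` of weight `p e₁ · p e₂` and closes
`e₁, e₂`; the map `Φ` pushes the product law forward onto the product law, `prob_series`, and
keeps every connection between vertices other than `x`, `conn_series`) transports the middle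
Bernstein coefficient `R½` of the leaf step exactly as it transports `HMFc` — through the
marks-only transport `LeafRowCutOneFar.Rhalf_transport_marks'`:

* **`Rhalf_series`**: for marks `o, a₁, a₂, w, b ≠ x`, `R½` of the reduced graph equals `R½` of
  `G`; hence **`LeafRow_series_iff`**: the row on `G` is the row on the reduced graph.

So a smallest counterexample to row (LEAF-½) has no unmarked vertex of degree two (and, by
`LeafDelete.LeafRow_update_loop`, no unmarked leaf).  Own work; standard axioms.
-/

namespace Summit.Ventures.PercRepro2

open UnionCluster CovForm LeafStep SeriesEdge

namespace LeafRowSeries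

variable {V : Type*} {E : Type*} [Fintype E] [DecidableEq E] {R : Type*} [Field R]
variable {ends : E → Sym2 V} {e₁ e₂ : E} {u y x : V}

/-- **`R½` transports along the series reduction** at an unmarked vertex `x` of degree two
(`e₁ = {u, x}`, `e₂ = {x, y}` its only edges): for marks `o, a₁, a₂, w, b ≠ x`,
`R½(G_reduced) = R½(G)`. -/
theorem Rhalf_series (he₁ : ends e₁ = s(u, x)) (he₂ : ends e₂ = s(x, y))
    (hx : ∀ e, x ∈ ends e → e = e₁ ∨ e = e₂) (hux : u ≠ x) (hyx : y ≠ x) (hne : e₁ ≠ e₂)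
    (p : E → R) {o a₁ a₂ w b : V} (ho : o ≠ x) (h1 : a₁ ≠ x) (h2 : a₂ ≠ x) (hw : w ≠ x)
    (hb : b ≠ x) :
    Rhalf (p' p e₁ e₂) (ends' ends u y) o a₁ a₂ w b = Rhalf p ends o a₁ a₂ w b := by
  refine LeafRowCutOneFar.Rhalf_transport_marks' (fun A => prob_series p hne A) o a₁ a₂ w b
    (fun ω m hm z hz => conn_series he₁ he₂ hx hux hyx ?_ ?_)
  · simp only [Set.mem_insert_iff, Set.mem_singleton_iff] at hm
    rcases hm with rfl | rfl | rfl | rfl | rfl <;> assumption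
  · simp only [Set.mem_insert_iff, Set.mem_singleton_iff] at hz
    rcases hz with rfl | rfl | rfl | rfl | rfl <;> assumption

/-- **Row (LEAF-½) is invariant under the series reduction**: the row on `G` iff the row on the
graph with the path `u – x – y` replaced by the edge `{u, y}` of weight `p e₁ · p e₂`. -/
theorem LeafRow_series_iff [LinearOrder R] (he₁ : ends e₁ = s(u, x)) (he₂ : ends e₂ = s(x, y))
    (hx : ∀ e, x ∈ ends e → e = e₁ ∨ e = e₂) (hux : u ≠ x) (hyx : y ≠ x) (hne : e₁ ≠ e₂)
    (p : E → R) {o a₁ a₂ w b : V} (ho : o ≠ x) (h1 : a₁ ≠ x) (h2 : a₂ ≠ x) (hw : w ≠ x)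
    (hb : b ≠ x) :
    LeafRow (p' p e₁ e₂) (ends' ends u y) o a₁ a₂ w b ↔ LeafRow p ends o a₁ a₂ w b := by
  unfold LeafRow
  rw [Rhalf_series he₁ he₂ hx hux hyx hne p ho h1 h2 hw hb]

end LeafRowSeries

end Summit.Ventures.PercRepro2
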